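import Summits.QuantumFields.YangMills.Theorems.LuscherReductionOneSiteLevelsValleyMain

/-!
# Crux RED `RunningReduction`, line «KTR» PART 8 — stub `TT.stub_oneSiteTail`, tool 2:
# the k-UNIFORM OUTER bound of the one-site transfer form

Support module for crux `RunningReduction` (route `LuscherReduction`, item stmt-QuantumFields-19978), registered stub
`TT.stub_oneSiteTail` (KTR PART 8; plan of record = ym-cruxidea-19978-2 g10's STUB-READING §3 step 1), fleet base ym-luscher-20007-p1 (gen 4).

ONE's OUTER seam (`absUpperOuter_of_valley`) is typed at the level-dependent rate `e^{−E_kλ_b + C₁λ_b²}`.  For the B-uniform window COUNT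
behind `OneSiteTail` only a k-FREE gain is needed, and the tree already holds it: `valley_gain` (transverse confinement along the toron valley,
gain `B^{−1/4}/2000`, fleet lead g2).  This file re-derives OUTER in gain currency:

* `qform_le_linkCE_mul_l2` — the trivial Schur bound `⟨ψ, K_B ψ⟩ ≤ linkCE B ‖ψ‖²` for physical `ψ`;
* `exp_neg_mul_onePhaseScale_le_half` — the large-field factor `e^{−B√λ_b} ≤ 1/2` for `B ≥ 1`;
* `outer_uniform` — **for `B ≥ B₂` and every physical `ψ`: `⟨sin Θ_B ψ, K_B sin Θ_B ψ⟩ ≤ linkCE B · (1 − B^{−1/4}/4000) ‖sin Θ_B ψ‖²`**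
  (`Θ_B = onePhase √λ_b`): second IMS cut along `Φ_B = magPhase √λ_b` (`qform_le_localized_cos_sin`, `defect_scale`, cost `O(λ_b²)`),
  `valley_gain` on the `cos Φ_B`-piece (it vanishes on the ball `‖zmCoord 1 U‖² < λ_b/4`, `valleyPiece_eq_zero_of_norm_zmCoord_sq_lt`),
  large-field suppression `e^{−B√λ_b}` on the `sin Φ_B`-piece (`qform_le_exp_neg_of_action_ge`, `lt_action_of_sin_magPhase_ne_zero`).

HONEST FRAMING: a k-uniform form bound for the ONE-SITE (`L = 1`) three-matrix `SU(2)` model, femto rung R2b1 bookkeeping; nothing here is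
infinite volume, a mass gap or Clay.  Sorry-free, no new definitions, no named-fact hypotheses.
-/

set_option autoImplicit false

noncomputable section

open MeasureTheory Filter Topology Real
open scoped Matrix ComplexConjugate BigOperators
open Literature.MathematicalPhysics.QuantumFieldTheory
open Literature.MathematicalPhysics.QuantumLattice
open Literature.Analysis.OperatorTheory.YMMatrixModel

namespace Summit.QuantumFields.YangMills.Theorems.FemtoTransferGap.OST

open Summit.QuantumFields.YangMills.Theorems.FemtoTransferGap

/-- **Schur bound**: `⟨ψ, K_B ψ⟩ ≤ linkCE B · ‖ψ‖²` for every physical `ψ` (`B ≥ 0`): the large-field lemma at threshold `η = 0`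
(`S ≥ 0`). [folklore] -/
theorem qform_le_linkCE_mul_l2 {B : ℝ} (hB : 0 ≤ B) {ψ : Cfg → ℝ} (hψ : IsPhys ψ) :
    qform su2Rep B ψ ψ ≤ linkCE B * l2 ψ ψ := by
  have h := qform_le_exp_neg_of_action_ge hB hψ (η := 0) (fun U _ => wilsonAction_su2_nonneg U)
  simpa using h

/-- `B · onePhaseScale B ≥ 1` for `B ≥ 1` (`(B√λ_b)⁶ = B⁶λ_b³ = 2B⁵`). [folklore] -/
theorem one_le_mul_onePhaseScale {B : ℝ} (hB : 1 ≤ B) : 1 ≤ B * onePhaseScale B := by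
  have hBpos : 0 < B := by linarith
  have hl : 0 < bareLambda B := bareLambda_pos' hBpos
  have hcube := bareLambda_cube hBpos
  -- `B² λ_b ≥ 1`
  have h1 : 1 ≤ B ^ 2 * bareLambda B := by
    by_contra h
    push Not at h
    have h2 : (B ^ 2 * bareLambda B) ^ 3 < 1 := by
      calc (B ^ 2 * bareLambda B) ^ 3 < 1 ^ 3 := pow_lt_pow_left₀ h (by positivity) three_ne_zero
        _ = 1 := one_pow 3
    have h3 : (B ^ 2 * bareLambda B) ^ 3 = 2 * B ^ 5 := by
      have : (B ^ 2 * bareLambda B) ^ 3 = B ^ 5 * (B * bareLambda B ^ 3) := by ring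
      rw [this, hcube]; ring
    have h4 : (1 : ℝ) ≤ B ^ 5 := one_le_pow₀ hB
    linarith
  -- `B √λ_b = √(B² λ_b)`
  have h2 : B * onePhaseScale B = Real.sqrt (B ^ 2 * bareLambda B) := by
    unfold onePhaseScale
    rw [Real.sqrt_mul' _ hl.le, Real.sqrt_sq hBpos.le]
  rw [h2]
  calc (1 : ℝ) = Real.sqrt 1 := Real.sqrt_one.symm
    _ ≤ Real.sqrt (B ^ 2 * bareLambda B) := Real.sqrt_le_sqrt h1

/-- The large-field factor at the magnetic threshold `√λ_b`: `e^{−B·√λ_b} ≤ 1/2` for `B ≥ 1`. [folklore] -/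
theorem exp_neg_mul_onePhaseScale_le_half {B : ℝ} (hB : 1 ≤ B) : Real.exp (-(B * onePhaseScale B)) ≤ 1 / 2 := by
  have h1 := one_le_mul_onePhaseScale hB
  calc Real.exp (-(B * onePhaseScale B)) ≤ Real.exp (-1) := Real.exp_le_exp.mpr (by linarith)
    _ ≤ 1 / 2 := by
        rw [Real.exp_neg]
        have he : (2 : ℝ) ≤ Real.exp 1 := by have := Real.exp_one_gt_d9; linarith
        rw [inv_le_comm₀ (Real.exp_pos 1) (by norm_num)]
        norm_num
        linarith

/-- **THE k-UNIFORM OUTER BOUND.**  For `B ≥ B₂` (some `B₂ ≥ 2`) and every physical `ψ`: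
`⟨sin Θ_B ψ, K_B sin Θ_B ψ⟩ ≤ linkCE B · (1 − B^{−1/4}/4000) · ‖sin Θ_B ψ‖²`, `Θ_B = onePhase (onePhaseScale B)`.
(IMS cut along `magPhase √λ_b`; `valley_gain` on the valley piece; `e^{−B√λ_b}` on the large-field piece.)
[cite: SimonB1983DiscreteSpectrum, §2–§3] [cite: Luscher1983, §2] -/
theorem outer_uniform : ∃ B₂ : ℝ, 2 ≤ B₂ ∧ ∀ B : ℝ, B₂ ≤ B → ∀ ψ : Cfg → ℝ, IsPhys ψ →
    qform su2Rep B (fun U => Real.sin (onePhase (onePhaseScale B) U) * ψ U) (fun U => Real.sin (onePhase (onePhaseScale B) U) * ψ U)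
      ≤ linkCE B * (1 - 1 / 4000 * B ^ (-(1 / 4 : ℝ)))
        * l2 (fun U => Real.sin (onePhase (onePhaseScale B) U) * ψ U) (fun U => Real.sin (onePhase (onePhaseScale B) U) * ψ U) := by
  obtain ⟨B₀, hB₀⟩ := valley_gain
  -- the IMS cost `D λ_b²`, `D = (9/4)·144π²·cM2`, is eventually below half the gain
  set D : ℝ := 9 / 4 * (144 * Real.pi ^ 2) * cM2 with hD
  have hD0 : 0 ≤ D := by rw [hD]; have := cM2_pos; positivity
  obtain ⟨T, hT1, hT⟩ := mul_bareLambda_le_gain (c₀ := 1 / 4000) (a := 1 / 4) (by norm_num) (by norm_num) D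
  refine ⟨max (max B₀ T) 2, le_max_right _ _, fun B hB ψ hψ => ?_⟩
  have hBB₀ : B₀ ≤ B := ((le_max_left _ _).trans (le_max_left _ _)).trans hB
  have hBT : T ≤ B := ((le_max_right _ _).trans (le_max_left _ _)).trans hB
  have hB2 : 2 ≤ B := (le_max_right _ _).trans hB
  have hB1 : 1 ≤ B := by linarith
  have hBpos : 0 < B := by linarith
  obtain ⟨hl0, hl1⟩ := bareLambda_pos_le_one hB2
  set x := bareLambda B with hx
  -- the `sin Θ`-piece as a physical function
  set ψ' : Cfg → ℝ := fun U => Real.sin (onePhase (onePhaseScale B) U) * ψ U with hψ'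
  have hψ'P : IsPhys ψ' := isPhys_sin_onePhase_mul _ hψ
  have hCE0 : 0 ≤ linkCE B := (linkCE_pos hBpos.le).le
  have hη : 0 < onePhaseScale B := onePhaseScale_pos hBpos
  -- IMS along the magnetic phase
  set Φ : Cfg → ℝ := magPhase (onePhaseScale B) with hΦ
  have hims := qform_le_localized_cos_sin hBpos (measurable_magPhase _) (Λ := 12 * Real.pi / onePhaseScale B)
    (div_nonneg (by positivity) hη.le) (fun U V => abs_magPhase_sub_le hη U V)
    (fun g U => magPhase_gaugeTransform _ g U) (fun j z hz U => magPhase_twist _ j hz U) hψ'P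
  have hscale := defect_scale (Λ := 12 * Real.pi / onePhaseScale B) hBpos (magPhaseScale_lipschitzSq hBpos)
  -- valley piece
  have hcosm : Measurable fun U => Real.cos (Φ U) * ψ' U :=
    (Real.continuous_cos.measurable.comp (measurable_magPhase _)).mul hψ'P.measurable
  have hcosb : ∃ C : ℝ, ∀ U, |Real.cos (Φ U) * ψ' U| ≤ C := by
    obtain ⟨C, hC⟩ := hψ'P.bounded
    refine ⟨C, fun U => ?_⟩
    rw [abs_mul]
    exact (mul_le_of_le_one_left (abs_nonneg _) (Real.abs_cos_le_one _)).trans (hC U)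
  have hcos0 : ∀ U, ‖zmCoord 1 U‖ ^ 2 < bareLambda B / 4 → Real.cos (Φ U) * ψ' U = 0 := fun U hU =>
    valleyPiece_eq_zero_of_norm_zmCoord_sq_lt hBpos ψ hU
  have h1 := hB₀ B hBB₀ (fun U => Real.cos (Φ U) * ψ' U) hcosm hcosb hcos0
  -- large-field piece
  have hsinP : IsPhys (fun U => Real.sin (Φ U) * ψ' U) :=
    hψ'P.mul_of_invariant (J := fun U => Real.sin (Φ U)) (Real.continuous_sin.measurable.comp (measurable_magPhase _))
      (CJ := 1) (fun U => Real.abs_sin_le_one _) (fun g U => by simp only [hΦ, magPhase_gaugeTransform])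
      (fun j z hz U => by simp only [hΦ, magPhase_twist _ j hz U])
  have hηU : ∀ U, Real.sin (Φ U) * ψ' U ≠ 0 → onePhaseScale B ≤ wilsonAction su2Rep U :=
    fun U hU => (lt_action_of_sin_magPhase_ne_zero hη (left_ne_zero_of_mul hU)).le
  have h2 := qform_le_exp_neg_of_action_ge hBpos.le hsinP hηU
  have hhalf := exp_neg_mul_onePhaseScale_le_half hB1
  -- norms
  have hsum := l2_cos_mul_add_l2_sin_mul (measurable_magPhase (onePhaseScale B)) hψ'P
  set nc := l2 (fun U => Real.cos (Φ U) * ψ' U) (fun U => Real.cos (Φ U) * ψ' U) with hnc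
  set ns := l2 (fun U => Real.sin (Φ U) * ψ' U) (fun U => Real.sin (Φ U) * ψ' U) with hns
  set n := l2 ψ' ψ' with hn
  have hnc0 : 0 ≤ nc := l2_self_nonneg _
  have hns0 : 0 ≤ ns := l2_self_nonneg _
  have hn0 : 0 ≤ n := l2_self_nonneg _
  -- the gain and the cost
  set γ : ℝ := 1 / 2000 * B ^ (-(1 / 4 : ℝ)) with hγ
  have hγ0 : 0 ≤ γ := by rw [hγ]; positivity
  have hγle : γ ≤ 1 / 2000 := by
    rw [hγ]
    have : B ^ (-(1 / 4 : ℝ)) ≤ 1 := Real.rpow_le_one_of_one_le_of_nonpos hB1 (by norm_num)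
    linarith
  have hcost : (1 / 2) * (9 * (12 * Real.pi / onePhaseScale B) ^ 2 * (cM2 / B)) ≤ D * x ^ 2 := by rw [hD]; linarith
  have hDx : D * x ^ 2 ≤ γ / 2 := by
    have hx2 : x ^ 2 ≤ x := by nlinarith
    have h := hT B hBT
    rw [← hx] at h
    calc D * x ^ 2 ≤ D * x := mul_le_mul_of_nonneg_left hx2 hD0
      _ ≤ 1 / 4000 * B ^ (-(1 / 4 : ℝ)) := h
      _ = γ / 2 := by rw [hγ]; ring
  -- assemble
  have herr : (1 / 2) * (9 * (12 * Real.pi / onePhaseScale B) ^ 2 * (cM2 / B) * linkCE B) * n ≤ linkCE B * (D * x ^ 2) * n := by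
    calc (1 / 2) * (9 * (12 * Real.pi / onePhaseScale B) ^ 2 * (cM2 / B) * linkCE B) * n
        = ((1 / 2) * (9 * (12 * Real.pi / onePhaseScale B) ^ 2 * (cM2 / B))) * linkCE B * n := by ring
      _ ≤ (D * x ^ 2) * linkCE B * n := mul_le_mul_of_nonneg_right (mul_le_mul_of_nonneg_right hcost hCE0) hn0
      _ = linkCE B * (D * x ^ 2) * n := by ring
  have h1' : qform su2Rep B (fun U => Real.cos (Φ U) * ψ' U) (fun U => Real.cos (Φ U) * ψ' U) ≤ linkCE B * (1 - γ) * nc := h1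
  have h2' : qform su2Rep B (fun U => Real.sin (Φ U) * ψ' U) (fun U => Real.sin (Φ U) * ψ' U) ≤ linkCE B * (1 - γ) * ns := by
    refine h2.trans ?_
    have : Real.exp (-(B * onePhaseScale B)) ≤ 1 - γ := by linarith
    calc Real.exp (-(B * onePhaseScale B)) * linkCE B * ns = linkCE B * Real.exp (-(B * onePhaseScale B)) * ns := by ring
      _ ≤ linkCE B * (1 - γ) * ns := mul_le_mul_of_nonneg_right (mul_le_mul_of_nonneg_left this hCE0) hns0
  have htot : qform su2Rep B ψ' ψ' ≤ linkCE B * (1 - γ + D * x ^ 2) * n := by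
    calc qform su2Rep B ψ' ψ' ≤ linkCE B * (1 - γ) * nc + linkCE B * (1 - γ) * ns
          + (1 / 2) * (9 * (12 * Real.pi / onePhaseScale B) ^ 2 * (cM2 / B) * linkCE B) * n := by linarith [hims, h1', h2']
      _ = linkCE B * (1 - γ) * n + (1 / 2) * (9 * (12 * Real.pi / onePhaseScale B) ^ 2 * (cM2 / B) * linkCE B) * n := by
          rw [← hsum]; ring
      _ ≤ linkCE B * (1 - γ) * n + linkCE B * (D * x ^ 2) * n := by linarith [herr]
      _ = linkCE B * (1 - γ + D * x ^ 2) * n := by ring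
  have hfin : linkCE B * (1 - γ + D * x ^ 2) * n ≤ linkCE B * (1 - 1 / 4000 * B ^ (-(1 / 4 : ℝ))) * n := by
    refine mul_le_mul_of_nonneg_right (mul_le_mul_of_nonneg_left ?_ hCE0) hn0
    have : 1 / 4000 * B ^ (-(1 / 4 : ℝ)) = γ / 2 := by rw [hγ]; ring
    rw [this]; linarith
  exact htot.trans hfin

end Summit.QuantumFields.YangMills.Theorems.FemtoTransferGap.OST

end
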